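import Literature.Geometry.ComplexHyperbolic.UnitBallBounds
import Literature.Geometry.ComplexHyperbolic.UnitBallU21Borel
import Mathlib.MeasureTheory.Measure.Lebesgue.Complex
import Mathlib.MeasureTheory.Measure.Haar.OfBasis
import Mathlib.MeasureTheory.Group.Action
import Mathlib.MeasureTheory.Integral.Bochner.Set
import HarnessLib

/-!
# Lebesgue measure on the unit ball `𝔹² ⊂ ℂ²`

Topic `Geometry/ComplexHyperbolic`; namespace `Literature.Geometry.ComplexHyperbolic.BallModel`
(continuing `UnitBallU21`, `UnitBallBounds`, `UnitBallU21Borel`). Everything here is a definition or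
a PROVED lemma (Mathlib + tree only).

The tree's ball `Ball = {z : ℂ² // |z₀|² + |z₁|² < 1}` is a plain `def`, so none of Mathlib's
subtype instances for measurable structures apply to it automatically. This file equips `Ball` with

* its Borel σ-algebra (`instMeasurableSpaceBall := borel Ball`, `instBorelSpaceBall`), for which the
  inclusion `Ball → ℂ²` is a measurable embedding (`measurableEmbedding_coe`);
* the **Lebesgue measure of the ball** `ballVolume := Measure.comap Subtype.val volume`, i.e. the
  restriction of the Lebesgue measure of `ℂ² = ℝ⁴` (Mathlib's `volume` on `Fin 2 → ℂ`) to the open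
  ball, with the transfer formulas `ballVolume_apply`, `lintegral_ballVolume`,
  `setLIntegral_ballVolume`, `integral_ballVolume`, `setIntegral_ballVolume` to integrals over
  subsets of `ℂ²`, and the instances `IsFiniteMeasure` (the ball is bounded), `SigmaFinite`,
  `IsOpenPosMeasure`;
* measurability of the action of `U(2,1)` (`instMeasurableConstSMulU21Ball`, from
  `ContinuousSMul`) and of its subgroups (`instMeasurableConstSMulSubgroupBall`), so that
  `MeasureTheory.IsFundamentalDomain Δ 𝓕 ballVolume` makes sense for `Δ ≤ U(2,1)`.

This is the common ground for the Petersson / Bergman integrals over fundamental domains of ball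
quotients (W. Rudin, *Function Theory in the Unit Ball of ℂⁿ* (1980), §1.4 (the measures `ν`, `τ`
on `B`), §2.2) and for the chart formula expressing integrals of top forms over a compact ball
quotient as integrals over a fundamental domain.

References: W. Rudin, *Function Theory in the Unit Ball of ℂⁿ*, Grundlehren 241 (Springer 1980),
§1.4, Thm. 2.2.6; H. Jacobowitz, *An Introduction to CR Structures* (AMS 1990), Ch. 2 §1.

## Provenance

Written under the LEAN-IN-TREE rule for the pub-hodgecm formalisation cell (model-construction
sub-cell, seat mc-unitary-3 gen 2, MODEL-DAG node D2-chart, junction file shared with nodes R-B /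
D2-Haar). Nothing in this file is a claim of the manuscripts adjudicated by that cell.
-/

noncomputable section

open MeasureTheory MeasureTheory.Measure Set Topology

namespace Literature.Geometry.ComplexHyperbolic.BallModel

/-! ### The Borel structure of the ball -/

/-- The σ-algebra of the ball: the subtype σ-algebra induced from `ℂ²` (it is the Borel σ-algebra,
`instBorelSpaceBall`). Declared explicitly because `Ball` is a `def`. [folklore] -/
instance instMeasurableSpaceBall : MeasurableSpace Ball := Subtype.instMeasurableSpace

/-- The carrier set `{w : ℂ² | |w₀|² + |w₁|² < 1}` of the ball is open. [folklore] -/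
theorem isOpen_setOf_nsq_lt : IsOpen {w : Fin 2 → ℂ | nsq w < 1} :=
  isOpen_lt continuous_fun_nsq continuous_const

/-- The carrier set of the ball is measurable. [folklore] -/
theorem measurableSet_setOf_nsq_lt : MeasurableSet {w : Fin 2 → ℂ | nsq w < 1} :=
  isOpen_setOf_nsq_lt.measurableSet

/-- The inclusion `Ball → ℂ²` (written as a lambda with domain `Ball`, so that measure-level
statements about it rewrite smoothly; it is `Subtype.val`). [folklore] -/
theorem coe_eq_val : (fun z : Ball ↦ (z.1 : Fin 2 → ℂ)) = Subtype.val := rfl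

/-- The inclusion `Ball → ℂ²` is an open embedding. [folklore] -/
theorem isOpenEmbedding_coe : IsOpenEmbedding (fun z : Ball ↦ (z.1 : Fin 2 → ℂ)) :=
  isOpen_setOf_nsq_lt.isOpenEmbedding_subtypeVal

/-- The inclusion `Ball → ℂ²` is continuous. [folklore] -/
theorem continuous_coe : Continuous (fun z : Ball ↦ (z.1 : Fin 2 → ℂ)) :=
  continuous_subtype_val

/-- The range of the inclusion is the carrier set of the ball. [folklore] -/
theorem range_coe : range (fun z : Ball ↦ (z.1 : Fin 2 → ℂ)) = {w : Fin 2 → ℂ | nsq w < 1} :=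
  Subtype.range_coe

/-- **The inclusion `Ball → ℂ²` is a measurable embedding.** [folklore] -/
theorem measurableEmbedding_coe : MeasurableEmbedding (fun z : Ball ↦ (z.1 : Fin 2 → ℂ)) :=
  MeasurableEmbedding.subtype_coe measurableSet_setOf_nsq_lt

/-- The ball is a Borel space: the subtype σ-algebra of an open subset is the Borel σ-algebra of
the subspace topology. [folklore] -/
instance instBorelSpaceBall : BorelSpace Ball :=
  inferInstanceAs (BorelSpace {w : Fin 2 → ℂ // nsq w < 1})

/-- The inclusion `Ball → ℂ²` is measurable. [folklore] -/
theorem measurable_coe : Measurable (fun z : Ball ↦ (z.1 : Fin 2 → ℂ)) :=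
  measurableEmbedding_coe.measurable

/-- Images of measurable subsets of the ball are measurable in `ℂ²`. [folklore] -/
theorem measurableSet_image_coe {S : Set Ball} (hS : MeasurableSet S) :
    MeasurableSet ((fun z : Ball ↦ (z.1 : Fin 2 → ℂ)) '' S) :=
  measurableEmbedding_coe.measurableSet_image.2 hS

/-- Images of subsets of the ball lie in the ball. [folklore] -/
theorem image_coe_subset (S : Set Ball) :
    (fun z : Ball ↦ (z.1 : Fin 2 → ℂ)) '' S ⊆ {w | nsq w < 1} := by
  rintro _ ⟨z, -, rfl⟩
  exact z.2

/-! ### The Lebesgue measure of the ball -/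

/-- **The Lebesgue measure of the ball** `𝔹² ⊂ ℂ² = ℝ⁴`: the pull-back of Mathlib's `volume` on
`Fin 2 → ℂ` along the inclusion (Rudin's `ν` up to his normalisation `ν(B) = 1`).
[cite: Rudin1980, §1.4] -/
def ballVolume : Measure Ball :=
  Measure.comap (fun z : Ball ↦ (z.1 : Fin 2 → ℂ)) (volume : Measure (Fin 2 → ℂ))

/-- `ballVolume S = volume (S read in ℂ²)`. [folklore] -/
theorem ballVolume_apply (S : Set Ball) :
    ballVolume S = volume ((fun z : Ball ↦ (z.1 : Fin 2 → ℂ)) '' S) :=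
  measurableEmbedding_coe.comap_apply volume S

/-- `ballVolume S = volume (Subtype.val '' S)` (the same, with the image written through
`Subtype.val`). [folklore] -/
theorem ballVolume_apply' (S : Set Ball) :
    ballVolume S = volume (Subtype.val '' S : Set (Fin 2 → ℂ)) :=
  ballVolume_apply S

/-- `ballVolume` is the restriction of `volume` to the ball, pushed to the subtype:
`map val ballVolume = volume.restrict 𝔹²`. [folklore] -/
theorem map_coe_ballVolume :
    map (fun z : Ball ↦ (z.1 : Fin 2 → ℂ)) ballVolume =
      (volume : Measure (Fin 2 → ℂ)).restrict {w | nsq w < 1} := by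
  rw [ballVolume, measurableEmbedding_coe.map_comap, range_coe]

/-- Restricting `ballVolume` to `S ⊆ 𝔹²` and pushing to `ℂ²` gives `volume` restricted to `S`.
[folklore] -/
theorem map_coe_ballVolume_restrict (S : Set Ball) :
    map (fun z : Ball ↦ (z.1 : Fin 2 → ℂ)) (ballVolume.restrict S) =
      (volume : Measure (Fin 2 → ℂ)).restrict ((fun z : Ball ↦ (z.1 : Fin 2 → ℂ)) '' S) := by
  have h := measurableEmbedding_coe.restrict_map ballVolume ((fun z : Ball ↦ (z.1 : Fin 2 → ℂ)) '' S)
  have hinj : Function.Injective (fun z : Ball ↦ (z.1 : Fin 2 → ℂ)) := Subtype.val_injective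
  rw [hinj.preimage_image] at h
  rw [← h, map_coe_ballVolume, restrict_restrict_of_subset (image_coe_subset S)]

/-- Lower integrals against `ballVolume` are lower integrals over the ball in `ℂ²`. [folklore] -/
theorem lintegral_ballVolume (f : (Fin 2 → ℂ) → ENNReal) :
    ∫⁻ z, f z.1 ∂ballVolume = ∫⁻ w in {w | nsq w < 1}, f w ∂volume := by
  rw [← map_coe_ballVolume, measurableEmbedding_coe.lintegral_map]

/-- Lower integrals over `S ⊆ 𝔹²` against `ballVolume` are lower integrals over `S ⊂ ℂ²`.
[folklore] -/
theorem setLIntegral_ballVolume (f : (Fin 2 → ℂ) → ENNReal) (S : Set Ball) :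
    ∫⁻ z in S, f z.1 ∂ballVolume = ∫⁻ w in Subtype.val '' S, f w ∂volume := by
  show ∫⁻ z in S, f z.1 ∂ballVolume = ∫⁻ w in (fun z : Ball ↦ (z.1 : Fin 2 → ℂ)) '' S, f w ∂volume
  rw [← map_coe_ballVolume_restrict, measurableEmbedding_coe.lintegral_map]

/-- Integrals against `ballVolume` are integrals over the ball in `ℂ²`. [folklore] -/
theorem integral_ballVolume {F : Type*} [NormedAddCommGroup F] [NormedSpace ℝ F]
    (f : (Fin 2 → ℂ) → F) :
    ∫ z, f z.1 ∂ballVolume = ∫ w in {w | nsq w < 1}, f w ∂volume := by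
  rw [← map_coe_ballVolume, measurableEmbedding_coe.integral_map]

/-- **Integrals over a subset of the ball** against `ballVolume` are integrals over that subset
read in `ℂ²`. [folklore] -/
theorem setIntegral_ballVolume {F : Type*} [NormedAddCommGroup F] [NormedSpace ℝ F]
    (f : (Fin 2 → ℂ) → F) (S : Set Ball) :
    ∫ z in S, f z.1 ∂ballVolume = ∫ w in Subtype.val '' S, f w ∂volume := by
  show ∫ z in S, f z.1 ∂ballVolume = ∫ w in (fun z : Ball ↦ (z.1 : Fin 2 → ℂ)) '' S, f w ∂volume
  rw [← map_coe_ballVolume_restrict, measurableEmbedding_coe.integral_map]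

/-- Every function on the ball is the restriction of a function on `ℂ²` (extension by an
arbitrary value), so the transfer lemmas apply to all integrands. [folklore] -/
theorem exists_eq_comp_coe {F : Type*} [Nonempty F] (f : Ball → F) :
    ∃ g : (Fin 2 → ℂ) → F, f = fun z ↦ g z.1 :=
  ⟨Function.extend Subtype.val f (Classical.arbitrary _),
    funext fun z ↦ (Subtype.val_injective.extend_apply _ _ z).symm⟩

/-- The carrier of the ball is bounded: it lies in the closed ball of radius `1` of `ℂ²` (sup norm).
[folklore] -/
theorem setOf_nsq_lt_subset_closedBall :
    {w : Fin 2 → ℂ | nsq w < 1} ⊆ Metric.closedBall (0 : Fin 2 → ℂ) 1 := by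
  intro w hw
  rw [mem_closedBall_zero_iff, pi_norm_le_iff_of_nonneg zero_le_one]
  intro i
  have hw' : nsq w < 1 := hw
  have h0 : ‖w 0‖ ^ 2 ≤ 1 := by
    have := hw'.le; unfold nsq at this; nlinarith [sq_nonneg ‖w 1‖]
  have h1 : ‖w 1‖ ^ 2 ≤ 1 := by
    have := hw'.le; unfold nsq at this; nlinarith [sq_nonneg ‖w 0‖]
  fin_cases i
  · simpa using (sq_le_one_iff₀ (norm_nonneg _)).1 h0
  · simpa using (sq_le_one_iff₀ (norm_nonneg _)).1 h1

/-- The ball has finite Lebesgue measure. [folklore] -/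
theorem volume_setOf_nsq_lt_lt_top : volume {w : Fin 2 → ℂ | nsq w < 1} < ⊤ :=
  (measure_mono setOf_nsq_lt_subset_closedBall).trans_lt measure_closedBall_lt_top

/-- `ballVolume` is a finite measure. [folklore] -/
instance isFiniteMeasure_ballVolume : IsFiniteMeasure ballVolume := by
  refine ⟨?_⟩
  rw [ballVolume_apply]
  exact (measure_mono (image_coe_subset _)).trans_lt volume_setOf_nsq_lt_lt_top

/-- `ballVolume` is σ-finite. [folklore] -/
instance sigmaFinite_ballVolume : SigmaFinite ballVolume := inferInstance

/-- `ballVolume` charges every nonempty open subset of the ball. [folklore] -/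
instance isOpenPosMeasure_ballVolume : ballVolume.IsOpenPosMeasure := by
  refine ⟨fun U hU hne ↦ ?_⟩
  rw [ballVolume_apply]
  exact ((isOpenEmbedding_coe.isOpenMap U hU).measure_ne_zero volume (hne.image _))

/-- Compact subsets of the ball have finite measure. [folklore] -/
instance isFiniteMeasureOnCompacts_ballVolume : IsFiniteMeasureOnCompacts ballVolume :=
  inferInstance

/-! ### Measurability of the action of `U(2,1)` and its subgroups -/

/-- Each `g ∈ U(2,1)` acts on the ball by a measurable (indeed continuous) map. [folklore] -/
instance instMeasurableConstSMulU21Ball : MeasurableConstSMul U21 Ball :=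
  ⟨fun g ↦ (continuous_const_smul g).measurable⟩

/-- A subgroup `Δ ≤ U(2,1)` acts continuously on the ball in each variable. [folklore] -/
instance instContinuousConstSMulSubgroupBall (Δ : Subgroup U21) : ContinuousConstSMul Δ Ball :=
  ⟨fun γ ↦ continuous_const_smul (γ : U21)⟩

/-- A subgroup `Δ ≤ U(2,1)` acts on the ball by measurable maps. [folklore] -/
instance instMeasurableConstSMulSubgroupBall (Δ : Subgroup U21) : MeasurableConstSMul Δ Ball :=
  ⟨fun γ ↦ (continuous_const_smul (γ : U21)).measurable⟩

/-- The action of a subgroup element is the action of the underlying group element. [folklore] -/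
theorem subgroup_smul_def {Δ : Subgroup U21} (γ : Δ) (z : Ball) : γ • z = (γ : U21) • z := rfl

end Literature.Geometry.ComplexHyperbolic.BallModel

end
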